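import Summits.QuantumFields.YangMills.Theorems.UnitScaleTiltProp7TopMeanTwoBackgrounds
import HarnessLib

/-!
# Route `UnitScaleTilt`, crux K1 «MinimiserStabilityRegPr» (stmt-QuantumFields-19200), EX row `hGF[Lift]` (curved member) — **LOD LINE, PEN (L5″) (RN-near) INGREDIENT:
# THE ADJOINT TOP MEANS OF TWO BACKGROUNDS ON BLOCK-SUPPORTED COARSE VECTORS** — the `T`-row of the Gram-difference split
`(M_1 − M_W)d = (S_1 − S_W)(…) + S_W(G_1² − G_W²)(…) + S_W G_W²(T_1 − T_W)d` behind routeR-w3 g12's 2r-door ✓`Prop7GramDifferenceNearFarSplit` («(RN-near) = px5's (RB)-apparatus»):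
for a coarse section `d` supported on blocks whose ROW-T corner-comb frames are `δ_V`∕`δ_U`-close to `1`, the general pairing row
`‖⟪ι(Q''(toL2S y)) − ι(QU(toL2S y)), ι d⟫‖ ≤ δ_Q·‖toL2S y‖·‖ι d‖` (§1; `δ_Q = √(2κ)(9000L²ε₀ + 2δ_V + 2δ_U)` as in ✓`Prop7TopMeanTwoBackgrounds`) and, by duality through the
adjoint hypotheses `⟪ι(Q'' l), f⟫ = ⟪l, T f⟫`, `⟪ι(QU l), f⟫ = ⟪l, TU f⟫` of ✓`Prop7CutoffMassFormRows`, the `T`-row `‖T(ι d) − TU(ι d)‖ ≤ δ_Q·‖ι d‖` (§2).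

Cell `ym3-torus` (HUMAN RULING D-0037, YM ladder rung R3 — NOT d = 4, NOT infinite volume, NOT a mass gap, NOT Clay).  Width seat `ym3-torus-px5` gen 11; ★p1 g24 LOCATE-L6-ASSEMBLY
§1 Step I.2 (L5″), road (α); routeR-w3 g12 2026-08-30 01:54:13Z (RN-near).  THEOREMS ONLY (0 `def`, 0 `sorry`); `--supports stmt-QuantumFields-19200 --as helper`, count-neutral.
HONEST LABEL (★★OWNER RULING №33 (6)): curved γ-row supplier line (LOD localisation), pen (L5″); displayed data = the frame rows on the support of `d`; nothing of (3.49), Thm 3.1∕3.3,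
`h349`, `hGF`, EX ∕ 19200 is proved here.

References: T. Bałaban, CMP **99** (1985) 389–434 [Balaban1985BackgroundPropagators] ((3.16), (3.19) p.393, (3.21), (3.24) p.394); CMP **98** (1985) 17–51 [Balaban1985Averaging]
((19)–(20) p.21, (97) p.32).
-/

set_option autoImplicit false

noncomputable section

open scoped BigOperators Matrix.Norms.L2Operator InnerProductSpace ComplexConjugate

namespace Summit.QuantumFields.YangMills.Theorems.Prop7TopMeanAdjointTwoBackgrounds

open Literature.MathematicalPhysics.QuantumFieldTheory.Balaban1983to89
open T4Continuum BlockAveraging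
open BlockAveraging (Idx)
open B7Prop1Explicit (disp)
open B5Eq118OneStroke (iterBlockOf iterBlock)
open B15DeterminingSets (embIter)
open B10Eq27TorusAxialLog (holT axialT transl)
open B7TransferAnalyticMean (meanCLM)
open B11Eq103H1Complex (SiteL2K)
open Summit.QuantumFields.YangMills.Theorems.Prop8Chart (emlIterU)
open Literature.MathematicalPhysics.QuantumFieldTheory.Balaban1983to89.T3ContinuumYM3Torus
open T3SectALandauChart (bgUnits)
open T3PrintedRegularMinimiser (RegPr)
open T3PrintedRegularOrbits (sites_eq)
open T3LevelShift (siteShift)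
open Summit.QuantumFields.YangMills.Theorems.Prop7SectET3Transport (periodsT3)
open Summit.QuantumFields.YangMills.Theorems.Prop7SectET3HilbertLetters (W₂ toL2S)
open Summit.QuantumFields.YangMills.Theorems.Prop7TopMeanAdjointBlockLocal (inner_blockLift_eq_zero_of_disjoint)
open Summit.QuantumFields.YangMills.Theorems.Prop7TopMeanTwoBackgrounds (norm_topMean_sub_topMean_le normSq_lift_le_of_blockwise)

variable (F : T3Family) {n K : ℕ} {c₀ : ℝ} [Fact (0 < c₀)] {ε₀ : ℝ} (hε₀ : 0 < ε₀) (hε7 : 10 ^ 7 * (F.L : ℝ) ^ 3 * ε₀ ≤ 1)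
  (V : GaugeField (F.P K) 0 (Matrix.specialUnitaryGroup (Fin 2) ℂ)) (hreg : RegPr F n K ε₀ V)
  (Q'' : SiteL2K ℂ 3 (periodsT3 F K) c₀ W₂ →ₗ[ℂ] (Site (F.P K) (K - n) → Matrix (Fin 2) (Fin 2) ℂ))
  (hseq : ∀ lam : Site (F.P K) 0 → Matrix (Fin 2) (Fin 2) ℂ, ∃ ns : (j : ℕ) → Site (F.P K) j → Matrix (Fin 2) (Fin 2) ℂ, ns 0 = lam ∧
        (∀ (j : ℕ) (y : Site (F.P K) (j + 1)), ns (j + 1) y = ns j (emb y) - meanCLM (Idx (F.P K)) (Matrix (Fin 2) (Fin 2) ℂ) fun i : Idx (F.P K) =>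
          ns j (emb y) - ((holT (emlIterU j (bgUnits F K V)) (emb y) (stairWord i.2.1 (off i.1)) : (Matrix (Fin 2) (Fin 2) ℂ)ˣ) : Matrix (Fin 2) (Fin 2) ℂ) *
            ns j (transl (emb y) (disp (stairWord i.2.1 (off i.1)))) * (((holT (emlIterU j (bgUnits F K V)) (emb y) (stairWord i.2.1 (off i.1)))⁻¹ : (Matrix (Fin 2) (Fin 2) ℂ)ˣ) : Matrix (Fin 2) (Fin 2) ℂ)) ∧
        ns (K - n) = Q'' (toL2S F K c₀ lam))
  (U : GaugeField (F.P K) 0 (Matrix.specialUnitaryGroup (Fin 2) ℂ)) (hregU : RegPr F n K ε₀ U)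
  (QU : SiteL2K ℂ 3 (periodsT3 F K) c₀ W₂ →ₗ[ℂ] (Site (F.P K) (K - n) → Matrix (Fin 2) (Fin 2) ℂ))
  (hseqU : ∀ lam : Site (F.P K) 0 → Matrix (Fin 2) (Fin 2) ℂ, ∃ ns : (j : ℕ) → Site (F.P K) j → Matrix (Fin 2) (Fin 2) ℂ, ns 0 = lam ∧
        (∀ (j : ℕ) (y : Site (F.P K) (j + 1)), ns (j + 1) y = ns j (emb y) - meanCLM (Idx (F.P K)) (Matrix (Fin 2) (Fin 2) ℂ) fun i : Idx (F.P K) =>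
          ns j (emb y) - ((holT (emlIterU j (bgUnits F K U)) (emb y) (stairWord i.2.1 (off i.1)) : (Matrix (Fin 2) (Fin 2) ℂ)ˣ) : Matrix (Fin 2) (Fin 2) ℂ) *
            ns j (transl (emb y) (disp (stairWord i.2.1 (off i.1)))) * (((holT (emlIterU j (bgUnits F K U)) (emb y) (stairWord i.2.1 (off i.1)))⁻¹ : (Matrix (Fin 2) (Fin 2) ℂ)ˣ) : Matrix (Fin 2) (Fin 2) ℂ)) ∧
        ns (K - n) = QU (toL2S F K c₀ lam))
  (h : n ≤ K) {c₁ : ℝ} [Fact (0 < c₁)]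
  (ι : (Site (F.P K) (K - n) → Matrix (Fin 2) (Fin 2) ℂ) →ₗ[ℂ] SiteL2K ℂ 3 (periodsT3 F n) c₁ W₂)
  (hι : ∀ c, ι c = toL2S F n c₁ (fun z => c (siteShift (sites_eq F n K h) z)))

/-! ## §1 The general pairing row -/

include hε₀ hε7 hreg hseq hregU hseqU hι in
/-- ★★ **THE TWO LIFTED TOP MEANS PAIRED AGAINST A BLOCK-SUPPORTED COARSE SECTION**: if the corner-comb frames satisfy `‖C^V − 1‖ ≤ δ_V`, `‖C^U − 1‖ ≤ δ_U` (`0 ≤ δ_V, δ_U`) on every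
block `Y` with `d Y ≠ 0`, then for every `y`, `‖⟪ι(Q''(toL2S y)) − ι(QU(toL2S y)), ι d⟫‖ ≤ √(2κ)·(9000L²ε₀ + 2δ_V + 2δ_U)·‖toL2S y‖·‖ι d‖` (mask the difference section to
`supp d`: the complement is orthogonal to `ι d` by ✓`inner_blockLift_eq_zero_of_disjoint`, the mask obeys ✓`normSq_lift_le_of_blockwise` by ✓`norm_topMean_sub_topMean_le`).
[cite: Balaban1985BackgroundPropagators, (3.16), (3.19) p.393, (3.24) p.394; Balaban1985Averaging, (97) p.32] -/
theorem norm_inner_lift_topMean_sub_lift_le (d : Site (F.P K) (K - n) → Matrix (Fin 2) (Fin 2) ℂ) {δV δU : ℝ} (hδV : 0 ≤ δV) (hδU : 0 ≤ δU)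
    (hCV : ∀ Y : Site (F.P K) (K - n), d Y ≠ 0 → ∀ x ∈ iterBlock (K - n) Y, ‖(((axialT (bgUnits F K V) (Site.fibreSite 0 (K - n) (iterBlockOf (K - n) x) fun _ => (⟨0, pow_pos (F.P K).L_pos (K - n)⟩ : Fin ((F.P K).L ^ (K - n)))) (embIter (K - n) Y))⁻¹ *
          axialT (bgUnits F K V) (Site.fibreSite 0 (K - n) (iterBlockOf (K - n) x) fun _ => (⟨0, pow_pos (F.P K).L_pos (K - n)⟩ : Fin ((F.P K).L ^ (K - n)))) x : (Matrix (Fin 2) (Fin 2) ℂ)ˣ) : Matrix (Fin 2) (Fin 2) ℂ) - 1‖ ≤ δV)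
    (hCU : ∀ Y : Site (F.P K) (K - n), d Y ≠ 0 → ∀ x ∈ iterBlock (K - n) Y, ‖(((axialT (bgUnits F K U) (Site.fibreSite 0 (K - n) (iterBlockOf (K - n) x) fun _ => (⟨0, pow_pos (F.P K).L_pos (K - n)⟩ : Fin ((F.P K).L ^ (K - n)))) (embIter (K - n) Y))⁻¹ *
          axialT (bgUnits F K U) (Site.fibreSite 0 (K - n) (iterBlockOf (K - n) x) fun _ => (⟨0, pow_pos (F.P K).L_pos (K - n)⟩ : Fin ((F.P K).L ^ (K - n)))) x : (Matrix (Fin 2) (Fin 2) ℂ)ˣ) : Matrix (Fin 2) (Fin 2) ℂ) - 1‖ ≤ δU)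
    (y : Site (F.P K) 0 → Matrix (Fin 2) (Fin 2) ℂ) :
    ‖⟪ι (Q'' (toL2S F K c₀ y)) - ι (QU (toL2S F K c₀ y)), ι d⟫_ℂ‖
      ≤ Real.sqrt (2 * (c₁ * ((((F.P K).L : ℝ) ^ (F.P K).d) ^ (K - n))⁻¹ / c₀)) * (2 * (4500 * (F.L : ℝ) ^ 2 * ε₀) + 2 * δV + 2 * δU) * ‖toL2S F K c₀ y‖ * ‖ι d‖ := by
  classical
  have hc₀ : 0 < c₀ := Fact.out
  have hc₁ : 0 < c₁ := Fact.out
  set δ : ℝ := 2 * (4500 * (F.L : ℝ) ^ 2 * ε₀) + 2 * δV + 2 * δU with hδdef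
  have hδ0 : 0 ≤ δ := by rw [hδdef]; positivity
  set κ : ℝ := (c₁ * ((((F.P K).L : ℝ) ^ (F.P K).d) ^ (K - n))⁻¹ / c₀) with hκ
  have hκ0 : 0 ≤ κ := by rw [hκ]; have := (F.P K).L_pos; positivity
  set e : Site (F.P K) (K - n) → Matrix (Fin 2) (Fin 2) ℂ := fun Y => Q'' (toL2S F K c₀ y) Y - QU (toL2S F K c₀ y) Y with he
  set eM : Site (F.P K) (K - n) → Matrix (Fin 2) (Fin 2) ℂ := fun Y => if d Y ≠ 0 then e Y else 0 with heM
  set eC : Site (F.P K) (K - n) → Matrix (Fin 2) (Fin 2) ℂ := fun Y => if d Y ≠ 0 then 0 else e Y with heC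
  have hsplit : Q'' (toL2S F K c₀ y) - QU (toL2S F K c₀ y) = eM + eC := by
    funext Y
    simp only [Pi.sub_apply, Pi.add_apply, heM, heC, he]
    split_ifs <;> simp
  have hιsplit : ι (Q'' (toL2S F K c₀ y)) - ι (QU (toL2S F K c₀ y)) = ι eM + ι eC := by
    rw [← map_sub, hsplit, map_add]
  have horth : ⟪ι eC, ι d⟫_ℂ = 0 := by
    rw [hι, hι]
    refine inner_blockLift_eq_zero_of_disjoint F h eC d fun Y => ?_
    by_cases hY : d Y ≠ 0
    · left; simp only [heC, if_pos hY]
    · right; exact not_not.mp hY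
  have heMY : ∀ Y : Site (F.P K) (K - n), ‖eM Y‖ ≤ δ * (((((F.P K).L : ℝ) ^ (F.P K).d) ^ (K - n))⁻¹ * ∑ x ∈ iterBlock (K - n) Y, ‖y x‖) := by
    intro Y
    by_cases hY : d Y ≠ 0
    · simp only [heM, if_pos hY, he]
      exact norm_topMean_sub_topMean_le F hε₀ hε7 V hreg Q'' hseq U hregU QU hseqU y Y (hCV Y hY) (hCU Y hY)
    · simp only [heM, if_neg hY, norm_zero]
      have := (F.P K).L_pos
      exact mul_nonneg hδ0 (mul_nonneg (by positivity) (Finset.sum_nonneg fun _ _ => norm_nonneg _))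
  have hsqM := normSq_lift_le_of_blockwise F (c₀ := c₀) (c₁ := c₁) h eM y heMY
  have hM0 : 0 ≤ Real.sqrt (2 * κ) * δ * ‖toL2S F K c₀ y‖ := by positivity
  have hnM : ‖ι eM‖ ≤ Real.sqrt (2 * κ) * δ * ‖toL2S F K c₀ y‖ := by
    rw [hι]
    have eq : (Real.sqrt (2 * κ) * δ * ‖toL2S F K c₀ y‖) ^ 2 = 2 * δ ^ 2 * κ * ‖toL2S F K c₀ y‖ ^ 2 := by
      rw [mul_pow, mul_pow, Real.sq_sqrt (by positivity)]; ring
    have hsq' : ‖toL2S F n c₁ (fun z => eM (siteShift (sites_eq F n K h) z))‖ ^ 2 ≤ (Real.sqrt (2 * κ) * δ * ‖toL2S F K c₀ y‖) ^ 2 := by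
      rw [eq]; exact hsqM
    have := Real.sqrt_le_sqrt hsq'
    rwa [Real.sqrt_sq (norm_nonneg _), Real.sqrt_sq hM0] at this
  rw [hιsplit, inner_add_left, horth, add_zero]
  calc ‖⟪ι eM, ι d⟫_ℂ‖ ≤ ‖ι eM‖ * ‖ι d‖ := norm_inner_le_norm _ _
    _ ≤ (Real.sqrt (2 * κ) * δ * ‖toL2S F K c₀ y‖) * ‖ι d‖ := mul_le_mul_of_nonneg_right hnM (norm_nonneg _)
    _ = _ := by ring

/-! ## §2 Duality: the adjoints on block-supported coarse vectors -/

include hε₀ hε7 hreg hseq hregU hseqU hι in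
/-- ★★★ **THE `T`-ROW**: with the Hilbert-adjoint hypotheses `⟪ι(Q'' l), f⟫ = ⟪l, T f⟫`, `⟪ι(QU l), f⟫ = ⟪l, TU f⟫` (the `hT`∕`hTU` of ✓`Prop7CutoffMassFormRows`), for a coarse section `d`
whose support carries the frame rows: `‖T(ι d) − TU(ι d)‖ ≤ √(2κ)·(9000L²ε₀ + 2δ_V + 2δ_U)·‖ι d‖` (test §1 against `v = T(ι d) − TU(ι d) = toL2S(toL2S⁻¹ v)`:
`‖v‖² = re⟪v, v⟫ = re⟪ι(Q''v) − ι(QU v), ι d⟫ ≤ δ_Q‖v‖‖ι d‖`). [cite: Balaban1985BackgroundPropagators, (3.16), (3.21), (3.24) p.394; Balaban1985Averaging, (97) p.32] -/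
theorem norm_adjoint_sub_adjoint_le
    (T : SiteL2K ℂ 3 (periodsT3 F n) c₁ W₂ →ₗ[ℂ] SiteL2K ℂ 3 (periodsT3 F K) c₀ W₂) (hT : ∀ (l : SiteL2K ℂ 3 (periodsT3 F K) c₀ W₂) (f : SiteL2K ℂ 3 (periodsT3 F n) c₁ W₂), ⟪ι (Q'' l), f⟫_ℂ = ⟪l, T f⟫_ℂ)
    (TU : SiteL2K ℂ 3 (periodsT3 F n) c₁ W₂ →ₗ[ℂ] SiteL2K ℂ 3 (periodsT3 F K) c₀ W₂) (hTU : ∀ (l : SiteL2K ℂ 3 (periodsT3 F K) c₀ W₂) (f : SiteL2K ℂ 3 (periodsT3 F n) c₁ W₂), ⟪ι (QU l), f⟫_ℂ = ⟪l, TU f⟫_ℂ)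
    (d : Site (F.P K) (K - n) → Matrix (Fin 2) (Fin 2) ℂ) {δV δU : ℝ} (hδV : 0 ≤ δV) (hδU : 0 ≤ δU)
    (hCV : ∀ Y : Site (F.P K) (K - n), d Y ≠ 0 → ∀ x ∈ iterBlock (K - n) Y, ‖(((axialT (bgUnits F K V) (Site.fibreSite 0 (K - n) (iterBlockOf (K - n) x) fun _ => (⟨0, pow_pos (F.P K).L_pos (K - n)⟩ : Fin ((F.P K).L ^ (K - n)))) (embIter (K - n) Y))⁻¹ *
          axialT (bgUnits F K V) (Site.fibreSite 0 (K - n) (iterBlockOf (K - n) x) fun _ => (⟨0, pow_pos (F.P K).L_pos (K - n)⟩ : Fin ((F.P K).L ^ (K - n)))) x : (Matrix (Fin 2) (Fin 2) ℂ)ˣ) : Matrix (Fin 2) (Fin 2) ℂ) - 1‖ ≤ δV)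
    (hCU : ∀ Y : Site (F.P K) (K - n), d Y ≠ 0 → ∀ x ∈ iterBlock (K - n) Y, ‖(((axialT (bgUnits F K U) (Site.fibreSite 0 (K - n) (iterBlockOf (K - n) x) fun _ => (⟨0, pow_pos (F.P K).L_pos (K - n)⟩ : Fin ((F.P K).L ^ (K - n)))) (embIter (K - n) Y))⁻¹ *
          axialT (bgUnits F K U) (Site.fibreSite 0 (K - n) (iterBlockOf (K - n) x) fun _ => (⟨0, pow_pos (F.P K).L_pos (K - n)⟩ : Fin ((F.P K).L ^ (K - n)))) x : (Matrix (Fin 2) (Fin 2) ℂ)ˣ) : Matrix (Fin 2) (Fin 2) ℂ) - 1‖ ≤ δU) :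
    ‖T (ι d) - TU (ι d)‖ ≤ Real.sqrt (2 * (c₁ * ((((F.P K).L : ℝ) ^ (F.P K).d) ^ (K - n))⁻¹ / c₀)) * (2 * (4500 * (F.L : ℝ) ^ 2 * ε₀) + 2 * δV + 2 * δU) * ‖ι d‖ := by
  have hc₀ : 0 < c₀ := Fact.out
  have hc₁ : 0 < c₁ := Fact.out
  set v : SiteL2K ℂ 3 (periodsT3 F K) c₀ W₂ := T (ι d) - TU (ι d) with hv
  set δQ : ℝ := Real.sqrt (2 * (c₁ * ((((F.P K).L : ℝ) ^ (F.P K).d) ^ (K - n))⁻¹ / c₀)) * (2 * (4500 * (F.L : ℝ) ^ 2 * ε₀) + 2 * δV + 2 * δU) with hδQ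
  have hδQ0 : 0 ≤ δQ := by rw [hδQ]; have := (F.P K).L_pos; positivity
  -- `⟪v, v⟫ = ⟪ι(Q'' v) − ι(QU v), ι d⟫`
  have hpair : ⟪v, T (ι d) - TU (ι d)⟫_ℂ = ⟪ι (Q'' v) - ι (QU v), ι d⟫_ℂ := by
    rw [inner_sub_right, ← hT, ← hTU, inner_sub_left]
  have hrow := norm_inner_lift_topMean_sub_lift_le F hε₀ hε7 V hreg Q'' hseq U hregU QU hseqU h ι hι d hδV hδU hCV hCU ((toL2S F K c₀).symm v)
  simp only [LinearEquiv.apply_symm_apply] at hrow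
  have hsq : ‖v‖ ^ 2 ≤ δQ * ‖v‖ * ‖ι d‖ := by
    have e1 : ‖v‖ ^ 2 = RCLike.re ⟪v, T (ι d) - TU (ι d)⟫_ℂ := (inner_self_eq_norm_sq v).symm
    rw [e1, hpair]
    exact (RCLike.re_le_norm _).trans hrow
  by_cases hv0 : ‖v‖ = 0
  · rw [hv0]; positivity
  · have hvpos : 0 < ‖v‖ := lt_of_le_of_ne (norm_nonneg _) (Ne.symm hv0)
    have : ‖v‖ * ‖v‖ ≤ (δQ * ‖ι d‖) * ‖v‖ := by nlinarith [hsq]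
    exact le_of_mul_le_mul_right this hvpos

end Summit.QuantumFields.YangMills.Theorems.Prop7TopMeanAdjointTwoBackgrounds
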